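import Literature.NumberTheory.LFunctions.SuzukiUncertaintyLemmaProofs
import Literature.Analysis.DeBrangesSpaces.HardyPaleyWiener
import HarnessLib

/-!
# Suzuki 2021, Prop. 4.4 (non-vanishing of Fredholm determinants, conditional case): discharge of `Suzuki2021_prop44`

LINE 1 — LABEL: RH-FREE AS TYPED (an operator statement about one explicit integral kernel UNDER the
explicit hypothesis `E_ζ^{ω,ν} ∈ HB`; for `ω > ½` that hypothesis is a tree theorem
(`Suzuki2021_prop22_holds`), for `ω < ½` it is of RH strength and stays a hypothesis). FRAMING (cell
rh-crit, D-0074): corpus theorems are RH-FREE literature; nothing here is worded as progress toward RH.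
bears_on: B-C/B-P (LADDER-RH COLUMN 6 DBR — [Su21] §4.4 «conditional cases»; the `ω ≥ ½`
Hamiltonian `suzuki2021_windows_of_half_le` becomes unconditional). WHAT THIS IS NOT: not Lemma 3.2's
isometry, not Prop. 4.4 iii) (`‖𝖪[t]‖ < 1`, the stronger `Suzuki2021_prop44_norm`), not a criterion
or a route; nothing here bears on the truth of RH.

M. Suzuki, *Hamiltonians arising from L-functions in the Selberg class*, J. Funct. Anal. 281 (2021)
109116 = arXiv:1606.05726 [Suzuki2021Hamiltonians], Prop. 4.4 (p. 22–23), for `L = ζ`: under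
`E_L^{ω,ν} ∈ HB̄` and (2.8), «ii) `‖𝖪[t]f‖ ≠ ‖f‖` for every `0 ≠ f ∈ L²(−∞,t)` … In particular,
`1 ± 𝖪_L^{ω,ν}[t]` are invertible». The tree's named fact `Suzuki2021_prop44`
(`SuzukiCanonicalSystem.lean`) records: `E ∈ HB` and (2.8) ⇒ no unit eigenvalue of `𝖪[t]` on
`L²(−t,t)` for every `t ≥ 0` (`NoUnitEigenvalue`). This file proves `Suzuki2021_prop44_holds`.

## The printed proof and how it is followed

Printed (proof of Prop. 4.4 ii)): «Suppose that `‖𝖪[t]f‖ = ‖f‖`. Then `‖𝖯_t𝖪𝖯_t f‖ = ‖f‖ = ‖𝖪𝖯_t f‖`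
[`𝖪` is an isometry of `L²(ℝ)`, Lemma 3.2]. This implies supp `𝖪𝖯_t f ⊂ [−t, t]`. On the other hand
`𝖪𝖯_t f` has compact support only if `𝖪𝖯_t f = 0` by Lemma 4.4. Hence `f = 0` …». Followed here with
ONE declared deviation: Lemma 3.2's isometry `‖𝖪𝖯_t f‖ = ‖f‖` is replaced by the CONTRACTION
`‖𝖪𝖯_t f‖_{L²(ℝ)} ≤ ‖f‖` — all that the argument uses (`‖f‖ = ‖𝖯_t𝖪𝖯_t f‖ ≤ ‖𝖪𝖯_t f‖ ≤ ‖f‖`) — and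
the contraction is derived from `|Θ| ≤ 1` on `ℂ₊` alone: `E ∈ HB̄` gives `E ≠ 0` and
`|Θ(z)| = |E(z̄)|/|E(z)| < 1` on `ℂ₊` (§1); the Fourier–Laplace transform
`𝒢(w) = e^{iwt}Θ(w)∫_{(−t,t)}f(y)e^{−iwy}dy` of the translate `(𝖪𝖯_t f)(· − t)` lies in `H²(ℂ₊)` with
`∫‖𝒢(x+iy)‖²dx ≤ 2π∫|f|²` for every `y > 0` (Plancherel on horizontal lines, §2–§3); the tree's
Paley–Wiener theorem `Literature.Analysis.DeBrangesSpaces.exists_halfLine_laplace_of_hardy` produces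
`ψ ∈ L²(0,∞)` with transform `𝒢` and `‖ψ‖ ≤ ‖f‖`, and Fourier uniqueness on a line `Im w = 1 + ω`,
where `∫(𝖪𝖯_t f)(x)e^{iwx}dx = Θ(w)∫f e^{−iwy}` holds absolutely
(`SuzukiUncertainty.integral_kernelImage_mul_cexp`, eq. (4.9)), identifies `ψ = (𝖪𝖯_t f)(· − t)` (§4).
Lemma 4.4 is the tree theorem `Suzuki2021_lemma44_holds` (`SuzukiUncertaintyLemmaProofs.lean`).

## Main results

* `SuzukiConditionalWindows.norm_suzukiTheta_lt_one` — `E ∈ HB̄ ⇒ |Θ(z)| < 1` on `ℂ₊`.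
* `SuzukiConditionalWindows.kernelImage_contraction` — the contraction `𝖪𝖯_t f ∈ L²(ℝ)`,
  `∫_ℝ |𝖪𝖯_t f|² ≤ ∫_{(−t,t)} |f|²` under `E ∈ HB̄`, (2.8).
* `Suzuki2021_prop44_ii` — Prop. 4.4 ii) as typed in `Suzuki2021_prop44_norm` (under `HB̄`), free-standing.
* `Literature.NumberTheory.LFunctions.Suzuki2021_prop44_holds : Suzuki2021_prop44`.
* `suzuki2021_windows_of_half_le'` — the now hypothesis-free form of `suzuki2021_windows_of_half_le`
  (`ω ≥ ½`, `ν ≥ 1`, `νω > 1` ⇒ `NoUnitEigenvalue (suzukiKernel ω ν) t` for every `t ≥ 0`).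

## References

* [Suzuki2021Hamiltonians] M. Suzuki, J. Funct. Anal. 281 (2021) 109116 = arXiv:1606.05726, §4.4
  Prop. 4.4 (p. 22–23) and its proof; Lemma 3.2; §2.5; eq. (4.9).
* [Rudin1987] W. Rudin, *Real and Complex Analysis*, 3rd ed., Thm. 19.2 (Paley–Wiener).
-/

noncomputable section

open Complex MeasureTheory Filter Topology Set Metric
open scoped Real FourierTransform ComplexConjugate

namespace Literature.NumberTheory.LFunctions

namespace SuzukiConditionalWindows

/-! ## §1 `E ∈ HB̄` ⇒ `Θ` is holomorphic and bounded by `1` on `ℂ₊` -/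

/-- `‖E(z̄)‖ = ‖ξ(½−ω−iz)‖^ν`: `ξ(½+ω−i z̄) = conj ξ(½+ω+iz) = conj ξ(½−ω−iz)` (`ξ(s̄) = conj ξ(s)`,
`ξ(1−s) = ξ(s)`), i.e. `E♯(z) = E(−z)` for `E = E_ζ^{ω,ν}`. [cite: Suzuki2021Hamiltonians, eq. (2.5)] -/
theorem norm_suzukiE_conj (ω : ℝ) (ν : ℕ) (z : ℂ) :
    ‖suzukiE ω ν (conj z)‖ = ‖riemannXi (1 / 2 - ω - I * z)‖ ^ ν := by
  unfold suzukiE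
  rw [norm_pow]
  congr 1
  have h1 : (1 / 2 + (ω : ℂ) - I * conj z) = conj (1 / 2 + ω + I * z) := by
    apply Complex.ext <;> simp; ring
  rw [h1, riemannXi_conj_holds, Complex.norm_conj,
    show (1 / 2 + (ω : ℂ) + I * z) = 1 - (1 / 2 - ω - I * z) by ring, riemannXi_one_sub]

/-- Under `E ∈ HB̄`, `E(z) ≠ 0` on `ℂ₊`. [cite: Suzuki2021Hamiltonians, §1 eq. (1.3)] -/
theorem suzukiE_ne_zero_of_HBbar {ω : ℝ} {ν : ℕ} (hE : IsSuzukiHBbar (suzukiE ω ν)) {z : ℂ}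
    (hz : 0 < z.im) : suzukiE ω ν z ≠ 0 := by
  intro h0
  have := hE z hz
  rw [h0, norm_zero] at this
  exact (norm_nonneg _).not_gt this

/-- Under `E ∈ HB̄`, `ξ(½+ω−iz) ≠ 0` on `ℂ₊`. [cite: Suzuki2021Hamiltonians, §1 eq. (1.3)] -/
theorem riemannXi_ne_zero_of_HBbar {ω : ℝ} {ν : ℕ} (hν : 1 ≤ ν) (hE : IsSuzukiHBbar (suzukiE ω ν))
    {z : ℂ} (hz : 0 < z.im) : riemannXi (1 / 2 + ω - I * z) ≠ 0 := by
  intro h0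
  apply suzukiE_ne_zero_of_HBbar hE hz
  unfold suzukiE
  rw [h0, zero_pow (by omega)]

/-- **`E ∈ HB̄ ⇒ |Θ(z)| < 1` on `ℂ₊`** (`Θ = E♯/E`, `|E♯(z)| = |E(z̄)| < |E(z)|`): the «inner» bound of
§4.4, obtained directly from the definition of `HB̄` (no inner-function theory).
[cite: Suzuki2021Hamiltonians, §4.4 («Then Θ is inner in ℂ₊») and Lemma 3.1] -/
theorem norm_suzukiTheta_lt_one {ω : ℝ} {ν : ℕ} (hE : IsSuzukiHBbar (suzukiE ω ν)) {z : ℂ}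
    (hz : 0 < z.im) : ‖suzukiTheta ω ν z‖ < 1 := by
  have hEz := suzukiE_ne_zero_of_HBbar hE hz
  have hlt := hE z hz
  rw [norm_suzukiE_conj] at hlt
  unfold suzukiTheta
  rw [div_pow, norm_div, norm_pow, div_lt_one (by rwa [norm_pos_iff])]
  exact hlt

/-- Under `E ∈ HB̄`, `Θ` is holomorphic on `ℂ₊`. [cite: Suzuki2021Hamiltonians, Lemma 3.1] -/
theorem differentiableOn_suzukiTheta_of_HBbar {ω : ℝ} {ν : ℕ} (hν : 1 ≤ ν)
    (hE : IsSuzukiHBbar (suzukiE ω ν)) :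
    DifferentiableOn ℂ (suzukiTheta ω ν) {z : ℂ | 0 < z.im} := by
  intro z hz
  have hT := riemannXi_ne_zero_of_HBbar hν hE (show 0 < z.im from hz)
  have h1 : DifferentiableAt ℂ (fun w : ℂ ↦ (1 : ℂ) / 2 - ω - I * w) z := by fun_prop
  have h2 : DifferentiableAt ℂ (fun w : ℂ ↦ (1 : ℂ) / 2 + ω - I * w) z := by fun_prop
  unfold suzukiTheta
  exact ((((differentiable_riemannXi _).comp z h1).div ((differentiable_riemannXi _).comp z h2)
    hT).pow ν).differentiableWithinAt

/-! ## §2 The window transform `G(w) = ∫_{(−t,t)} g(v) e^{−iwv} dv` on horizontal lines (Plancherel) -/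

/-- On the line `Im w = y`, `G(2πξ + iy)` is the Fourier transform of `v ↦ g(v)e^{yv}`.
[cite: Rudin1987, Thm. 19.2 (proof)] -/
theorem windowTransform_line_eq_fourier (g : ℝ → ℂ) (y ξ : ℝ) :
    ∫ v : ℝ, g v * cexp (-(I * ((2 * π * ξ : ℝ) + y * I) * v)) =
      𝓕 (fun v : ℝ ↦ g v * (Real.exp (y * v) : ℂ)) ξ := by
  rw [Real.fourier_real_eq_integral_exp_smul]
  congr 1 with v
  rw [smul_eq_mul, Complex.ofReal_exp]
  rw [show cexp (↑(-2 * π * v * ξ) * I) * (g v * cexp (↑(y * v))) =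
    g v * (cexp (↑(-2 * π * v * ξ) * I) * cexp (↑(y * v))) by ring, ← Complex.exp_add]
  congr 2
  have : I * I = -1 := Complex.I_mul_I
  push_cast
  linear_combination (-(y : ℂ) * v) * this

/-- For `g ∈ L¹ ∩ L²` vanishing off `(−t,t)` and `y ≥ 0`: `v ↦ g(v)e^{yv}` is in `L¹ ∩ L²` with
`∫|g e^{y·}|² ≤ e^{2yt}∫|g|²`. [cite: Rudin1987, Thm. 19.2 (proof)] -/
theorem weighted_window_estimates {g : ℝ → ℂ} {t : ℝ} (hg1 : Integrable g) (hg2 : MemLp g 2 volume)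
    (hgt : ∀ v, v ∉ Ioo (-t) t → g v = 0) {y : ℝ} (hy : 0 ≤ y) :
    Integrable (fun v : ℝ ↦ g v * (Real.exp (y * v) : ℂ)) ∧
      MemLp (fun v : ℝ ↦ g v * (Real.exp (y * v) : ℂ)) 2 volume ∧
      ∫ v : ℝ, ‖g v * (Real.exp (y * v) : ℂ)‖ ^ 2 ≤ Real.exp (2 * y * t) * ∫ v : ℝ, ‖g v‖ ^ 2 := by
  have hb : ∀ v, ‖g v * (Real.exp (y * v) : ℂ)‖ ≤ Real.exp (y * t) * ‖g v‖ := by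
    intro v
    by_cases hv : v ∈ Ioo (-t) t
    · rw [norm_mul, Complex.norm_real, Real.norm_eq_abs, abs_of_pos (Real.exp_pos _), mul_comm]
      exact mul_le_mul_of_nonneg_right (Real.exp_le_exp.2 (by nlinarith [hv.2])) (norm_nonneg _)
    · rw [hgt v hv]; simp
  have hmeas : AEStronglyMeasurable (fun v : ℝ ↦ g v * (Real.exp (y * v) : ℂ)) volume :=
    hg1.aestronglyMeasurable.mul (by fun_prop : Continuous fun v : ℝ ↦ (Real.exp (y * v) : ℂ)).aestronglyMeasurable
  have h1 : Integrable (fun v : ℝ ↦ g v * (Real.exp (y * v) : ℂ)) :=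
    Integrable.mono' (hg1.norm.const_mul _) hmeas (Eventually.of_forall hb)
  have h2 : MemLp (fun v : ℝ ↦ g v * (Real.exp (y * v) : ℂ)) 2 volume :=
    MemLp.of_le (hg2.norm.const_mul (Real.exp (y * t))) hmeas (Eventually.of_forall fun v ↦ by
      rw [Real.norm_eq_abs, abs_mul, abs_of_pos (Real.exp_pos _), abs_norm]; exact hb v)
  refine ⟨h1, h2, ?_⟩
  have hsq : Integrable (fun v : ℝ ↦ ‖g v‖ ^ 2) := (memLp_two_iff_integrable_sq_norm hg2.1).1 hg2
  calc ∫ v : ℝ, ‖g v * (Real.exp (y * v) : ℂ)‖ ^ 2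
      ≤ ∫ v : ℝ, Real.exp (2 * y * t) * ‖g v‖ ^ 2 := by
        refine integral_mono_of_nonneg (Eventually.of_forall fun v ↦ by positivity)
          (hsq.const_mul _) (Eventually.of_forall fun v ↦ ?_)
        have := hb v
        have h0 : 0 ≤ ‖g v * (Real.exp (y * v) : ℂ)‖ := norm_nonneg _
        calc ‖g v * (Real.exp (y * v) : ℂ)‖ ^ 2 ≤ (Real.exp (y * t) * ‖g v‖) ^ 2 :=
              pow_le_pow_left₀ h0 this 2
          _ = Real.exp (2 * y * t) * ‖g v‖ ^ 2 := by
              rw [mul_pow, ← Real.exp_nat_mul]; push_cast; ring_nf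
    _ = Real.exp (2 * y * t) * ∫ v : ℝ, ‖g v‖ ^ 2 := integral_const_mul _ _

/-- **Plancherel on the line `Im w = y ≥ 0`** for the window transform: `x ↦ ‖G(x+iy)‖²` is integrable
and `∫_ℝ ‖G(x+iy)‖² dx ≤ 2π e^{2yt} ∫|g|²`. [cite: Rudin1987, Thm. 19.2 (proof)] -/
theorem integral_norm_sq_windowTransform_line {g : ℝ → ℂ} {t : ℝ} (hg1 : Integrable g)
    (hg2 : MemLp g 2 volume) (hgt : ∀ v, v ∉ Ioo (-t) t → g v = 0) {y : ℝ} (hy : 0 ≤ y) :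
    Integrable (fun x : ℝ ↦ ‖∫ v : ℝ, g v * cexp (-(I * ((x : ℂ) + y * I) * v))‖ ^ 2) ∧
      ∫ x : ℝ, ‖∫ v : ℝ, g v * cexp (-(I * ((x : ℂ) + y * I) * v))‖ ^ 2 ≤
        2 * π * Real.exp (2 * y * t) * ∫ v : ℝ, ‖g v‖ ^ 2 := by
  obtain ⟨h1, h2, h3⟩ := weighted_window_estimates hg1 hg2 hgt hy
  set φ : ℝ → ℂ := fun v : ℝ ↦ g v * (Real.exp (y * v) : ℂ) with hφ
  -- `F(x) := ‖G(x+iy)‖²` and `F(2πξ) = ‖𝓕φ ξ‖²`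
  set F : ℝ → ℝ := fun x ↦ ‖∫ v : ℝ, g v * cexp (-(I * ((x : ℂ) + y * I) * v))‖ ^ 2 with hF
  have hFξ : ∀ ξ : ℝ, F (2 * π * ξ) = ‖𝓕 φ ξ‖ ^ 2 := by
    intro ξ
    simp only [hF]
    rw [← windowTransform_line_eq_fourier g y ξ]
  have hFφ : Integrable (fun ξ : ℝ ↦ ‖𝓕 φ ξ‖ ^ 2) := by
    have hm := Literature.Analysis.FunctionSpaces.memLp_two_fourierIntegral h1 h2
    exact (memLp_two_iff_integrable_sq_norm hm.1).1 hm
  have h2π : (2 * π : ℝ) ≠ 0 := by positivity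
  have hFint : Integrable F := by
    have : Integrable (fun ξ : ℝ ↦ F (2 * π * ξ)) := by simp_rw [hFξ]; exact hFφ
    exact (integrable_comp_mul_left_iff F h2π).1 this
  refine ⟨hFint, ?_⟩
  have hcv : ∫ ξ : ℝ, F (2 * π * ξ) = |(2 * π)⁻¹| • ∫ x : ℝ, F x :=
    Measure.integral_comp_mul_left F (2 * π)
  rw [smul_eq_mul, abs_of_pos (by positivity)] at hcv
  have hI : ∫ x : ℝ, F x = 2 * π * ∫ ξ : ℝ, F (2 * π * ξ) := by
    rw [hcv]; field_simp
  show ∫ x : ℝ, F x ≤ 2 * π * Real.exp (2 * y * t) * ∫ v : ℝ, ‖g v‖ ^ 2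
  rw [hI]
  simp_rw [hFξ]
  rw [Literature.Analysis.FunctionSpaces.integral_norm_sq_fourierIntegral_eq h1 h2]
  have h2π0 : (0 : ℝ) ≤ 2 * π := by positivity
  calc 2 * π * ∫ x : ℝ, ‖φ x‖ ^ 2 ≤ 2 * π * (Real.exp (2 * y * t) * ∫ v : ℝ, ‖g v‖ ^ 2) :=
        mul_le_mul_of_nonneg_left h3 h2π0
    _ = 2 * π * Real.exp (2 * y * t) * ∫ v : ℝ, ‖g v‖ ^ 2 := by ring

/-! ## §3 The Hardy function `𝒢(w) = e^{iwt}Θ(w)G(w)` and its Paley–Wiener representative -/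

/-- `∫ g(v)e^{−iwv}dv = weilMellin g (½ − iw)`. [folklore] -/
private theorem windowTransform_eq_weilMellin (g : ℝ → ℂ) (w : ℂ) :
    ∫ v : ℝ, g v * cexp (-(I * w * v)) = weilMellin g (1 / 2 + -(I * w)) := by
  unfold weilMellin
  congr 1 with v
  congr 2
  ring

/-- `w ↦ ∫ g(v)e^{−iwv}dv` is entire for `g` living on `[−t,t]`. [cite: Rudin1987, Thm. 19.2 (proof)] -/
theorem differentiable_windowTransform {g : ℝ → ℂ} {t : ℝ} (hg1 : Integrable g)
    (hg_ae : ∀ᵐ v : ℝ, v ∉ Icc (-t) t → g v = 0) :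
    Differentiable ℂ fun w : ℂ ↦ ∫ v : ℝ, g v * cexp (-(I * w * v)) := by
  have hd := (SuzukiUncertainty.differentiable_weilMellin_of_window hg1.integrableOn hg_ae).comp
    (by fun_prop : Differentiable ℂ fun w : ℂ ↦ (1 : ℂ) / 2 + -(I * w))
  have : (fun w : ℂ ↦ ∫ v : ℝ, g v * cexp (-(I * w * v))) =
      (weilMellin g) ∘ (fun w : ℂ ↦ (1 : ℂ) / 2 + -(I * w)) := by
    funext w; exact windowTransform_eq_weilMellin g w
  rw [this]
  exact hd

/-- **The Paley–Wiener representative.** Under `E ∈ HB̄`, for `g ∈ L¹ ∩ L²` living on `(−t,t)`,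
`t ≥ 0`: the function `𝒢(w) = e^{iwt}Θ(w)∫g(v)e^{−iwv}dv` is holomorphic on `ℂ₊` with
`∫‖𝒢(x+iy)‖²dx ≤ 2π∫|g|²` (`|Θ| ≤ 1`, Plancherel), so by Paley–Wiener it is `∫₀^∞ ψ(x)e^{iwx}dx` for some
`ψ ∈ L²(0,∞)` with `∫|ψ|² ≤ ∫|g|²`. [cite: Rudin1987, Thm. 19.2; Suzuki2021Hamiltonians, Lemma 3.2 (proof)] -/
theorem exists_halfLine_rep {ω : ℝ} {ν : ℕ} (hν : 1 ≤ ν) (hE : IsSuzukiHBbar (suzukiE ω ν))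
    {g : ℝ → ℂ} {t : ℝ} (hg1 : Integrable g) (hg2 : MemLp g 2 volume)
    (hgt : ∀ v, v ∉ Ioo (-t) t → g v = 0) :
    ∃ ψ : ℝ → ℂ, MemLp ψ 2 volume ∧ (∀ᵐ x : ℝ, x < 0 → ψ x = 0) ∧
      ∫ x : ℝ, ‖ψ x‖ ^ 2 ≤ ∫ v : ℝ, ‖g v‖ ^ 2 ∧
      ∀ w : ℂ, 0 < w.im → ∫ x in Ioi (0 : ℝ), ψ x * cexp (I * w * x) =
        cexp (I * w * t) * suzukiTheta ω ν w * ∫ v : ℝ, g v * cexp (-(I * w * v)) := by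
  have hg_ae : ∀ᵐ v : ℝ, v ∉ Icc (-t) t → g v = 0 :=
    Eventually.of_forall fun v hv ↦ hgt v fun hv' ↦ hv (Ioo_subset_Icc_self hv')
  set Gw : ℂ → ℂ := fun w ↦ ∫ v : ℝ, g v * cexp (-(I * w * v)) with hGw
  set 𝒢 : ℂ → ℂ := fun w ↦ cexp (I * w * t) * suzukiTheta ω ν w * Gw w with h𝒢
  have hGwd : Differentiable ℂ Gw := differentiable_windowTransform hg1 hg_ae
  have hd : DifferentiableOn ℂ 𝒢 {z : ℂ | 0 < z.im} := by
    simp only [h𝒢]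
    exact ((by fun_prop : Differentiable ℂ fun w : ℂ ↦ cexp (I * w * t)).differentiableOn.mul
      (differentiableOn_suzukiTheta_of_HBbar hν hE)).mul hGwd.differentiableOn
  set M : ℝ := Real.sqrt (2 * π * ∫ v : ℝ, ‖g v‖ ^ 2) with hM
  have hM0 : 0 ≤ M := Real.sqrt_nonneg _
  have hM2 : M ^ 2 = 2 * π * ∫ v : ℝ, ‖g v‖ ^ 2 := by
    rw [hM, Real.sq_sqrt (by positivity)]
  -- pointwise bound on the lines: `‖𝒢(x+iy)‖² ≤ e^{−2yt} ‖G(x+iy)‖²`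
  have hpt : ∀ y : ℝ, 0 < y → ∀ x : ℝ,
      ‖𝒢 ((x : ℂ) + y * I)‖ ^ 2 ≤ Real.exp (-(2 * y * t)) * ‖Gw ((x : ℂ) + y * I)‖ ^ 2 := by
    intro y hy x
    have him : 0 < (((x : ℂ) + y * I)).im := by simpa using hy
    have hΘ := (norm_suzukiTheta_lt_one hE him).le
    have hex : ‖cexp (I * ((x : ℂ) + y * I) * t)‖ = Real.exp (-(y * t)) := by
      rw [Complex.norm_exp]
      congr 1
      simp [mul_re, mul_im]
    simp only [h𝒢]
    rw [norm_mul, norm_mul, hex, mul_pow, mul_pow]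
    have h1 : ‖suzukiTheta ω ν ((x : ℂ) + y * I)‖ ^ 2 ≤ 1 := by
      calc _ ≤ (1 : ℝ) ^ 2 := pow_le_pow_left₀ (norm_nonneg _) hΘ 2
        _ = 1 := one_pow 2
    have h2 : Real.exp (-(y * t)) ^ 2 = Real.exp (-(2 * y * t)) := by
      rw [← Real.exp_nat_mul]; congr 1; push_cast; ring
    rw [h2]
    have h3 : 0 ≤ Real.exp (-(2 * y * t)) * ‖Gw ((x : ℂ) + y * I)‖ ^ 2 := by positivity
    nlinarith
  have hline := fun y (hy : 0 < y) ↦ integral_norm_sq_windowTransform_line hg1 hg2 hgt hy.le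
  have h2 : ∀ y : ℝ, 0 < y → Integrable (fun x : ℝ ↦ ‖𝒢 ((x : ℂ) + y * I)‖ ^ 2) := by
    intro y hy
    have hcont : Continuous fun x : ℝ ↦ 𝒢 ((x : ℂ) + y * I) := by
      refine (hd.continuousOn.comp_continuous (by fun_prop) fun x ↦ ?_)
      simpa using hy
    refine Integrable.mono' ((hline y hy).1.const_mul (Real.exp (-(2 * y * t))))
      (hcont.norm.pow 2).aestronglyMeasurable (Eventually.of_forall fun x ↦ ?_)
    rw [Real.norm_eq_abs, abs_of_nonneg (by positivity)]
    exact hpt y hy x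
  have hMb : ∀ y : ℝ, 0 < y → ∫ x : ℝ, ‖𝒢 ((x : ℂ) + y * I)‖ ^ 2 ≤ M ^ 2 := by
    intro y hy
    have hexp : Real.exp (-(2 * y * t)) * (2 * π * Real.exp (2 * y * t)) = 2 * π := by
      rw [show Real.exp (-(2 * y * t)) * (2 * π * Real.exp (2 * y * t)) =
        2 * π * (Real.exp (-(2 * y * t)) * Real.exp (2 * y * t)) by ring, ← Real.exp_add]
      simp
    calc ∫ x : ℝ, ‖𝒢 ((x : ℂ) + y * I)‖ ^ 2
        ≤ ∫ x : ℝ, Real.exp (-(2 * y * t)) * ‖Gw ((x : ℂ) + y * I)‖ ^ 2 :=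
          integral_mono_of_nonneg (Eventually.of_forall fun x ↦ by positivity)
            ((hline y hy).1.const_mul _) (Eventually.of_forall (hpt y hy))
      _ = Real.exp (-(2 * y * t)) * ∫ x : ℝ, ‖Gw ((x : ℂ) + y * I)‖ ^ 2 := integral_const_mul _ _
      _ ≤ Real.exp (-(2 * y * t)) * (2 * π * Real.exp (2 * y * t) * ∫ v : ℝ, ‖g v‖ ^ 2) :=
          mul_le_mul_of_nonneg_left (hline y hy).2 (Real.exp_pos _).le
      _ = M ^ 2 := by rw [hM2, ← mul_assoc, hexp]
  obtain ⟨ψ, hψ2, hψ0, hψM, hψrep⟩ :=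
    Literature.Analysis.DeBrangesSpaces.exists_halfLine_laplace_of_hardy hd h2 hMb hM0
  refine ⟨ψ, hψ2, hψ0, ?_, fun w hw ↦ ?_⟩
  · rw [hM2] at hψM
    exact le_of_mul_le_mul_left hψM (by positivity)
  · rw [hψrep w hw]

/-! ## §4 The contraction `‖𝖪𝖯_t f‖_{L²(ℝ)} ≤ ‖f‖` -/

/-- The image `x ↦ ∫_{(−t,t)} K(x+y) f(y) dy` of an integrable `f` under a continuous kernel is
continuous (dominated convergence on bounded `x`-ranges). [folklore] -/
private theorem continuous_kernelImage {K : ℝ → ℝ} (hK : Continuous K) {t : ℝ} {f : ℝ → ℝ}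
    (hf : Integrable f (volume.restrict (Ioo (-t) t))) :
    Continuous fun x ↦ ∫ y in Ioo (-t) t, K (x + y) * f y := by
  rw [continuous_iff_continuousAt]
  intro x₀
  obtain ⟨C, hC⟩ := (isCompact_Icc (a := x₀ - 1 - |t|) (b := x₀ + 1 + |t|)).exists_bound_of_continuousOn
    hK.continuousOn
  refine continuousAt_of_dominated (bound := fun y ↦ C * ‖f y‖) ?_ ?_ (hf.norm.const_mul C) ?_
  · exact Eventually.of_forall fun x ↦
      ((hK.comp (continuous_const.add continuous_id)).aestronglyMeasurable.mul hf.aestronglyMeasurable)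
  · filter_upwards [Metric.ball_mem_nhds x₀ one_pos] with x hx
    filter_upwards [ae_restrict_mem measurableSet_Ioo] with y hy
    rw [norm_mul]
    refine mul_le_mul_of_nonneg_right (hC _ ⟨?_, ?_⟩) (norm_nonneg _)
    · rw [Metric.mem_ball, Real.dist_eq] at hx
      have := (abs_lt.1 hx).1
      cases abs_cases t <;> linarith [hy.1, hy.2]
    · rw [Metric.mem_ball, Real.dist_eq] at hx
      have := (abs_lt.1 hx).2
      cases abs_cases t <;> linarith [hy.1, hy.2]
  · exact Eventually.of_forall fun y ↦
      ((hK.comp (continuous_id.add continuous_const)).continuousAt.mul continuousAt_const)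

/-- Fourier uniqueness on `L¹ ∩ L²` (Plancherel): equal Fourier transforms ⇒ equal a.e. [folklore] -/
private theorem ae_eq_of_fourier_eq {φ₁ φ₂ : ℝ → ℂ} (h1 : Integrable φ₁) (h1' : MemLp φ₁ 2 volume)
    (h2 : Integrable φ₂) (h2' : MemLp φ₂ 2 volume) (heq : ∀ ξ : ℝ, 𝓕 φ₁ ξ = 𝓕 φ₂ ξ) :
    φ₁ =ᵐ[volume] φ₂ := by
  have hd1 : Integrable (fun x ↦ φ₁ x - φ₂ x) := h1.sub h2
  have hd2 : MemLp (fun x ↦ φ₁ x - φ₂ x) 2 volume := h1'.sub h2'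
  have hF : 𝓕 (fun x ↦ φ₁ x - φ₂ x) = 0 := by
    funext ξ
    rw [Pi.zero_apply, Real.fourier_eq]
    simp_rw [smul_sub]
    rw [integral_sub ((Real.fourierIntegral_convergent_iff ξ).2 h1)
      ((Real.fourierIntegral_convergent_iff ξ).2 h2), ← Real.fourier_eq, ← Real.fourier_eq, heq ξ,
      sub_self]
  have hint0 : ∫ x : ℝ, ‖φ₁ x - φ₂ x‖ ^ 2 = 0 := by
    rw [← Literature.Analysis.FunctionSpaces.integral_norm_sq_fourierIntegral_eq hd1 hd2, hF]
    simp
  have hsq : Integrable (fun x ↦ ‖φ₁ x - φ₂ x‖ ^ 2) := (memLp_two_iff_integrable_sq_norm hd2.1).1 hd2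
  have := (integral_eq_zero_iff_of_nonneg (fun x ↦ by positivity) hsq).1 hint0
  filter_upwards [this] with x hx
  have : ‖φ₁ x - φ₂ x‖ = 0 := by simpa using hx
  exact sub_eq_zero.1 (norm_eq_zero.1 this)

/-- An a.e. bound `|h| ≤ C e^{vx}` for the image `h(x) = ∫_{(−t,t)} K(x+y) f(y) dy` from the kernel
growth `|K(u)| ≤ D e^{vu}` ([Su21] Prop. 4.1 (5)): `|h(x)| ≤ D e^{v(x+t)} ∫_{(−t,t)}|f|` (`v ≥ 0`).
[cite: Suzuki2021Hamiltonians, Prop. 4.1 (5)] -/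
theorem abs_kernelImage_le {K : ℝ → ℝ} {D v : ℝ} (hv : 0 ≤ v)
    (hD : ∀ u : ℝ, |K u| ≤ D * Real.exp (v * u)) {t : ℝ} {f : ℝ → ℝ}
    (hf : Integrable f (volume.restrict (Ioo (-t) t))) (x : ℝ) :
    |∫ y in Ioo (-t) t, K (x + y) * f y| ≤
      D * Real.exp (v * (x + t)) * ∫ y in Ioo (-t) t, |f y| := by
  have hD0 : 0 ≤ D := by
    have := hD 0
    have h0 : 0 ≤ |K 0| := abs_nonneg _
    rw [mul_zero, Real.exp_zero, mul_one] at this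
    linarith
  rw [← Real.norm_eq_abs, ← integral_const_mul]
  refine norm_integral_le_of_norm_le (hf.abs.const_mul _) ?_
  filter_upwards [ae_restrict_mem measurableSet_Ioo] with y hy
  rw [Real.norm_eq_abs, abs_mul]
  refine mul_le_mul_of_nonneg_right ((hD (x + y)).trans ?_) (abs_nonneg _)
  exact mul_le_mul_of_nonneg_left (Real.exp_le_exp.2 (by nlinarith [hy.2])) hD0

/-- **The contraction** (the half of [Su21] Lemma 3.2 that Prop. 4.4 uses): under `E ∈ HB̄` and (2.8),
for `t ≥ 0` and `f ∈ L²(−t,t)`, the image `h = 𝖪𝖯_t f`, `h(x) = ∫_{(−t,t)} K_ζ^{ω,ν}(x+y)f(y)dy`, lies in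
`L²(ℝ)` and `∫_ℝ h² ≤ ∫_{(−t,t)} f²`. Printed: `𝖪` is an isometry of `L²(ℝ)` when `Θ` is inner (Lemma
3.2); here only `‖𝖪𝖯_t f‖ ≤ ‖f‖` is derived, from `|Θ| ≤ 1` on `ℂ₊`, via Paley–Wiener for
`e^{iwt}Θ(w)·(𝖥𝖯_t f)(−w) ∈ H²(ℂ₊)` and Fourier uniqueness on the line `Im w = 1 + ω`.
[cite: Suzuki2021Hamiltonians, Lemma 3.2 and proof of Prop. 4.4 ii)] -/
theorem kernelImage_contraction {ω : ℝ} (hω : 0 < ω) {ν : ℕ} (hν : 1 ≤ ν) (hνω : 1 < (ν : ℝ) * ω)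
    (hE : IsSuzukiHBbar (suzukiE ω ν)) {t : ℝ} (ht : 0 ≤ t) {f : ℝ → ℝ}
    (hf : MemLp f 2 (volume.restrict (Ioo (-t) t))) :
    MemLp (fun x ↦ ∫ y in Ioo (-t) t, suzukiKernel ω ν (x + y) * f y) 2 volume ∧
      ∫ x : ℝ, (∫ y in Ioo (-t) t, suzukiKernel ω ν (x + y) * f y) ^ 2 ≤ ∫ y in Ioo (-t) t, f y ^ 2 := by
  set K : ℝ → ℝ := suzukiKernel ω ν with hKdef
  set μ : Measure ℝ := volume.restrict (Ioo (-t) t) with hμ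
  set h : ℝ → ℝ := fun x ↦ ∫ y in Ioo (-t) t, K (x + y) * f y with hh
  haveI : IsFiniteMeasure μ := isFiniteMeasure_restrict.2 measure_Ioo_lt_top.ne
  have hf1 : Integrable f μ := hf.integrable one_le_two
  -- the test function `g = f 𝟙_{(−t,t)}` (complex-valued)
  set g : ℝ → ℂ := (Ioo (-t) t).indicator (fun y ↦ ((f y : ℝ) : ℂ)) with hg
  have hg1 : Integrable g := by
    rw [hg, integrable_indicator_iff measurableSet_Ioo]; exact hf1.ofReal
  have hg2 : MemLp g 2 volume := by
    rw [hg, memLp_indicator_iff_restrict measurableSet_Ioo]; exact hf.ofReal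
  have hgt : ∀ y, y ∉ Ioo (-t) t → g y = 0 := fun y hy ↦ Set.indicator_of_notMem hy _
  -- `∫‖g‖² = ∫_{(−t,t)} f²`
  have hg_sq : ∫ v : ℝ, ‖g v‖ ^ 2 = ∫ y in Ioo (-t) t, f y ^ 2 := by
    have : (fun v : ℝ ↦ ‖g v‖ ^ 2) = (Ioo (-t) t).indicator (fun y ↦ f y ^ 2) := by
      funext v
      by_cases hv : v ∈ Ioo (-t) t
      · simp [hg, hv]
      · simp [hg, hv]
    rw [this, integral_indicator measurableSet_Ioo]
  -- kernel facts
  have hK0 : ∀ x : ℝ, x < 0 → K x = 0 := fun x hx ↦ (suzuki2021_prop41_i hω hν hνω hx).1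
  have hKc : Continuous K := suzuki2021_prop41_iv hω ν hνω
  have hv : 1 / 2 + ω < 3 / 4 + ω := by linarith
  obtain ⟨D, hD0, hD⟩ := suzuki2021_prop41_v hω ν hνω hv
  have hhneg : ∀ x : ℝ, x ≤ -t → h x = 0 := by
    intro x hx
    refine setIntegral_eq_zero_of_forall_eq_zero fun y hy ↦ ?_
    rw [hK0 _ (by linarith [hy.2]), zero_mul]
  have hcont : Continuous h := continuous_kernelImage hKc hf1
  have hhC : ∀ x : ℝ, (h x : ℂ) = ∫ y : ℝ, ((K (x + y) : ℝ) : ℂ) * g y := by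
    intro x
    simp only [hh]
    rw [← integral_complex_ofReal, ← integral_indicator measurableSet_Ioo]
    congr 1 with y
    by_cases hy : y ∈ Ioo (-t) t
    · simp [hg, hy]
    · simp [hg, hy]
  have hhb : ∀ x : ℝ, |h x| ≤ D * Real.exp ((3 / 4 + ω) * (x + t)) * ∫ y in Ioo (-t) t, |f y| :=
    abs_kernelImage_le (by linarith) hD hf1
  -- the translate `k = h(· − t)`, supported in `[0, ∞)`
  set k : ℝ → ℝ := fun x ↦ h (x - t) with hk
  have hkc : Continuous k := hcont.comp (continuous_id.sub continuous_const)
  have hk0 : ∀ x : ℝ, x ≤ 0 → k x = 0 := fun x hx ↦ hhneg (x - t) (by linarith)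
  -- the Paley–Wiener representative
  obtain ⟨ψ, hψ2, hψ0, hψle, hψrep⟩ := exists_halfLine_rep hν hE hg1 hg2 hgt
  -- the comparison line `Im w = c = 1 + ω`
  set c : ℝ := 1 + ω with hc
  have hc0 : 0 < c := by rw [hc]; linarith
  set φ₁ : ℝ → ℂ := (Ioi (0 : ℝ)).indicator (fun x ↦ ψ x * cexp (-(c : ℂ) * x)) with hφ₁
  set φ₂ : ℝ → ℂ := fun x ↦ (k x : ℂ) * cexp (-(c : ℂ) * x) with hφ₂
  -- integrability of `φ₁`
  have hφ₁_on : IntegrableOn (fun x ↦ ψ x * cexp (-(c : ℂ) * x)) (Ioi 0) := by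
    have := Literature.Analysis.DeBrangesSpaces.integrableOn_mul_cexp_Ioi_of_memLp hψ2
      (w := (c : ℂ) * I) (by simpa using hc0)
    refine this.congr_fun (fun x _ ↦ ?_) measurableSet_Ioi
    have e : I * ((c : ℂ) * I) * (x : ℂ) = -(c : ℂ) * x := by
      linear_combination ((c : ℂ) * x) * Complex.I_mul_I
    simp only [e]
  have hφ₁_int : Integrable φ₁ := by
    rw [hφ₁, integrable_indicator_iff measurableSet_Ioi]; exact hφ₁_on
  have hφ₁_le : ∀ x, ‖φ₁ x‖ ≤ ‖ψ x‖ := by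
    intro x
    by_cases hx : x ∈ Ioi (0 : ℝ)
    · rw [hφ₁, Set.indicator_of_mem hx, norm_mul, Complex.norm_exp]
      have : (-(c : ℂ) * x).re = -(c * x) := by simp
      rw [this]
      have hx' : 0 < x := hx
      have : Real.exp (-(c * x)) ≤ 1 := by rw [Real.exp_le_one_iff]; nlinarith
      calc ‖ψ x‖ * Real.exp (-(c * x)) ≤ ‖ψ x‖ * 1 := mul_le_mul_of_nonneg_left this (norm_nonneg _)
        _ = ‖ψ x‖ := mul_one _
    · rw [hφ₁, Set.indicator_of_notMem hx, norm_zero]; exact norm_nonneg _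
  have hφ₁_2 : MemLp φ₁ 2 volume :=
    MemLp.of_le hψ2 hφ₁_int.aestronglyMeasurable (Eventually.of_forall hφ₁_le)
  -- integrability of `φ₂`: `|φ₂(x)| ≤ C e^{−x/4}` on `(0,∞)`, `0` on `(−∞,0]`
  set C : ℝ := D * Real.exp ((3 / 4 + ω) * t) * ∫ y in Ioo (-t) t, |f y| with hC
  have hC0 : 0 ≤ C := by rw [hC]; positivity
  have hφ₂_le : ∀ x, ‖φ₂ x‖ ≤ (Ioi (0 : ℝ)).indicator (fun x ↦ C * Real.exp (-(1 / 4 : ℝ) * x)) x := by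
    intro x
    by_cases hx : x ∈ Ioi (0 : ℝ)
    · rw [Set.indicator_of_mem hx, hφ₂]
      simp only
      rw [norm_mul, Complex.norm_real, Complex.norm_exp, Real.norm_eq_abs]
      have hre : (-(c : ℂ) * x).re = -(c * x) := by simp
      rw [hre]
      have h1 := hhb (x - t)
      rw [show x - t + t = x by ring] at h1
      calc |k x| * Real.exp (-(c * x)) ≤
          (D * Real.exp ((3 / 4 + ω) * x) * ∫ y in Ioo (-t) t, |f y|) * Real.exp (-(c * x)) :=
            mul_le_mul_of_nonneg_right h1 (Real.exp_pos _).le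
        _ = (D * ∫ y in Ioo (-t) t, |f y|) * (Real.exp ((3 / 4 + ω) * x) * Real.exp (-(c * x))) := by
            ring
        _ = (D * ∫ y in Ioo (-t) t, |f y|) * Real.exp (-(1 / 4 : ℝ) * x) := by
            rw [← Real.exp_add]; congr 2; rw [hc]; ring
        _ ≤ C * Real.exp (-(1 / 4 : ℝ) * x) := by
            refine mul_le_mul_of_nonneg_right ?_ (Real.exp_pos _).le
            rw [hC]
            have : (1 : ℝ) ≤ Real.exp ((3 / 4 + ω) * t) := Real.one_le_exp (by positivity)
            have hI : 0 ≤ ∫ y in Ioo (-t) t, |f y| := integral_nonneg fun y ↦ abs_nonneg _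
            nlinarith
    · rw [Set.indicator_of_notMem hx, hφ₂]
      simp only
      rw [hk0 x (not_lt.1 hx)]
      simp
  have hmaj : Integrable ((Ioi (0 : ℝ)).indicator (fun x ↦ C * Real.exp (-(1 / 4 : ℝ) * x))) := by
    rw [integrable_indicator_iff measurableSet_Ioi]
    exact (exp_neg_integrableOn_Ioi 0 (by norm_num : (0 : ℝ) < 1 / 4)).const_mul C
  have hφ₂_meas : AEStronglyMeasurable φ₂ volume :=
    ((continuous_ofReal.comp hkc).mul (by fun_prop)).aestronglyMeasurable
  have hφ₂_int : Integrable φ₂ := Integrable.mono' hmaj hφ₂_meas (Eventually.of_forall hφ₂_le)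
  have hφ₂_bdd : ∀ x, ‖φ₂ x‖ ≤ C := by
    intro x
    refine (hφ₂_le x).trans ?_
    by_cases hx : x ∈ Ioi (0 : ℝ)
    · rw [Set.indicator_of_mem hx]
      have hx' : 0 < x := hx
      have : Real.exp (-(1 / 4 : ℝ) * x) ≤ 1 := by rw [Real.exp_le_one_iff]; nlinarith
      nlinarith
    · rw [Set.indicator_of_notMem hx]; exact hC0
  have hφ₂_2 : MemLp φ₂ 2 volume := by
    refine (memLp_two_iff_integrable_sq_norm hφ₂_meas).2 ?_
    refine Integrable.mono' (hφ₂_int.norm.const_mul C) (hφ₂_meas.norm.pow 2) ?_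
    refine Eventually.of_forall fun x ↦ ?_
    rw [Real.norm_eq_abs, abs_of_nonneg (by positivity), sq]
    exact mul_le_mul_of_nonneg_right (hφ₂_bdd x) (norm_nonneg _)
  -- the two transforms agree: both equal `𝒢(u + ic)`
  have htrans₂ : ∀ u : ℝ, ∫ x : ℝ, φ₂ x * cexp (I * u * x) =
      cexp (I * ((u : ℂ) + c * I) * t) * suzukiTheta ω ν ((u : ℂ) + c * I) *
        ∫ v : ℝ, g v * cexp (-(I * ((u : ℂ) + c * I) * v)) := by
    intro u
    set w : ℂ := (u : ℂ) + c * I with hw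
    have hwim : 1 / 2 + ω < w.im := by rw [hw]; simp [hc]; linarith
    obtain ⟨hKi, hKΘ⟩ := suzuki2021_prop41_fourier hω hν hνω hwim
    have main := SuzukiUncertainty.integral_kernelImage_mul_cexp (K := fun x ↦ ((K x : ℝ) : ℂ))
      (continuous_ofReal.comp hKc) hKi hKΘ hg1 hgt
    -- `∫ φ₂ e^{iux} = ∫ k(x) e^{iwx} dx = ∫ h(y) e^{iw(y+t)} dy = e^{iwt} ∫ h e^{iwy}`
    have e1 : ∀ x : ℝ, φ₂ x * cexp (I * u * x) = (k x : ℂ) * cexp (I * w * x) := by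
      intro x
      rw [hφ₂]; simp only
      rw [mul_assoc, ← Complex.exp_add]
      congr 2
      rw [hw]
      have : I * I = -1 := Complex.I_mul_I
      linear_combination (-(c : ℂ) * x) * this
    simp_rw [e1]
    have e2 : ∫ x : ℝ, (k x : ℂ) * cexp (I * w * x) =
        ∫ y : ℝ, ((h y : ℝ) : ℂ) * cexp (I * w * (((y + t : ℝ) : ℂ))) := by
      rw [← integral_sub_right_eq_self (fun x : ℝ ↦ (k x : ℂ) * cexp (I * w * x)) (-t)]
      congr 1 with y
      simp [hk]
    rw [e2]
    have e3 : ∀ y : ℝ, ((h y : ℝ) : ℂ) * cexp (I * w * (((y + t : ℝ) : ℂ))) =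
        cexp (I * w * t) * (((h y : ℝ) : ℂ) * cexp (I * w * y)) := by
      intro y
      push_cast
      rw [show I * w * ((y : ℂ) + t) = I * w * t + I * w * y by ring, Complex.exp_add]
      ring
    simp_rw [e3]
    rw [integral_const_mul]
    simp_rw [hhC]
    rw [main.2]
    ring
  have htrans₁ : ∀ u : ℝ, ∫ x : ℝ, φ₁ x * cexp (I * u * x) =
      cexp (I * ((u : ℂ) + c * I) * t) * suzukiTheta ω ν ((u : ℂ) + c * I) *
        ∫ v : ℝ, g v * cexp (-(I * ((u : ℂ) + c * I) * v)) := by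
    intro u
    have hwim : 0 < (((u : ℂ) + c * I)).im := by simpa using hc0
    rw [← hψrep _ hwim, hφ₁, ← integral_indicator measurableSet_Ioi]
    congr 1 with x
    by_cases hx : x ∈ Ioi (0 : ℝ)
    · rw [Set.indicator_of_mem hx, Set.indicator_of_mem hx, mul_assoc, ← Complex.exp_add]
      congr 2
      have : I * I = -1 := Complex.I_mul_I
      linear_combination (-(c : ℂ) * x) * this
    · rw [Set.indicator_of_notMem hx, Set.indicator_of_notMem hx, zero_mul]
  have hFeq : ∀ ξ : ℝ, 𝓕 φ₁ ξ = 𝓕 φ₂ ξ := by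
    intro ξ
    have e : ∀ φ : ℝ → ℂ, 𝓕 φ ξ = ∫ x : ℝ, φ x * cexp (I * ((-(2 * π * ξ) : ℝ) : ℂ) * x) := by
      intro φ
      rw [Real.fourier_real_eq_integral_exp_smul]
      congr 1 with x
      rw [smul_eq_mul, mul_comm]
      congr 1
      push_cast
      ring_nf
    rw [e, e, htrans₁, htrans₂]
  have hae : φ₁ =ᵐ[volume] φ₂ := ae_eq_of_fourier_eq hφ₁_int hφ₁_2 hφ₂_int hφ₂_2 hFeq
  -- hence `ψ = k` a.e., so `k ∈ L²` with `∫ k² = ∫‖ψ‖² ≤ ∫‖g‖²`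
  have hψk : ψ =ᵐ[volume] fun x ↦ (k x : ℂ) := by
    have hnull : ({0} : Set ℝ)ᶜ ∈ ae (volume : Measure ℝ) :=
      compl_mem_ae_iff.2 (measure_singleton 0)
    filter_upwards [hae, hψ0, hnull] with x hx hx0 hxne
    replace hxne : x ≠ 0 := hxne
    rcases lt_or_gt_of_ne hxne with hlt | hgt'
    · rw [hx0 hlt, hk0 x hlt.le]; simp
    · have hmem : x ∈ Ioi (0 : ℝ) := hgt'
      rw [hφ₁, Set.indicator_of_mem hmem, hφ₂] at hx
      simp only at hx
      exact mul_right_cancel₀ (Complex.exp_ne_zero _) hx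
  have hk2C : MemLp (fun x ↦ (k x : ℂ)) 2 volume := hψ2.ae_eq hψk
  have hk_sq_int : Integrable (fun x ↦ k x ^ 2) := by
    have := (memLp_two_iff_integrable_sq_norm hk2C.1).1 hk2C
    refine this.congr (Eventually.of_forall fun x ↦ ?_)
    simp [sq_abs]
  have hk2 : MemLp k 2 volume := by
    refine (memLp_two_iff_integrable_sq_norm hkc.aestronglyMeasurable).2 ?_
    refine hk_sq_int.congr (Eventually.of_forall fun x ↦ ?_)
    simp [sq_abs]
  have hk_int_le : ∫ x : ℝ, k x ^ 2 ≤ ∫ y in Ioo (-t) t, f y ^ 2 := by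
    have e1 : ∫ x : ℝ, k x ^ 2 = ∫ x : ℝ, ‖ψ x‖ ^ 2 := by
      refine integral_congr_ae ?_
      filter_upwards [hψk] with x hx
      rw [hx]; simp [sq_abs]
    rw [e1, ← hg_sq]; exact hψle
  -- back to `h = k(· + t)`
  have hh_eq : ∀ x, h x = k (x + t) := fun x ↦ by simp [hk]
  refine ⟨?_, ?_⟩
  · show MemLp h 2 volume
    refine (memLp_two_iff_integrable_sq_norm hcont.aestronglyMeasurable).2 ?_
    have := hk_sq_int.comp_add_right t
    refine this.congr (Eventually.of_forall fun x ↦ ?_)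
    simp [hh_eq, sq_abs]
  · show ∫ x : ℝ, h x ^ 2 ≤ ∫ y in Ioo (-t) t, f y ^ 2
    have : ∫ x : ℝ, h x ^ 2 = ∫ x : ℝ, k x ^ 2 := by
      simp_rw [hh_eq]
      exact integral_add_right_eq_self (fun x : ℝ ↦ k x ^ 2) t
    rw [this]; exact hk_int_le

/-! ## §5 Prop. 4.4: no `f ≠ 0` with `‖𝖪[t]f‖ ≥ ‖f‖`; no unit eigenvalue -/

/-- **Core of the printed proof of Prop. 4.4 ii)**: under `E ∈ HB̄` and (2.8), if
`∫_{(−t,t)} f² ≤ ∫_{(−t,t)} (𝖪𝖯_t f)²` then `f = 0` a.e. on `(−t,t)`. («Then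
`‖𝖯_t𝖪𝖯_tf‖ = ‖f‖ = ‖𝖪𝖯_tf‖`. This implies supp `𝖪𝖯_t f ⊂ [−t,t]` … only if `𝖪𝖯_t f = 0` by Lemma 4.4.
Hence `f = 0`.») [cite: Suzuki2021Hamiltonians, Prop. 4.4 ii) (proof)] -/
theorem ae_eq_zero_of_sq_integral_le {ω : ℝ} (hω : 0 < ω) {ν : ℕ} (hν : 1 ≤ ν)
    (hνω : 1 < (ν : ℝ) * ω) (hE : IsSuzukiHBbar (suzukiE ω ν)) {t : ℝ} (ht : 0 ≤ t) {f : ℝ → ℝ}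
    (hf : MemLp f 2 (volume.restrict (Ioo (-t) t)))
    (hle : ∫ y in Ioo (-t) t, f y ^ 2 ≤
      ∫ x in Ioo (-t) t, (∫ y in Ioo (-t) t, suzukiKernel ω ν (x + y) * f y) ^ 2) :
    f =ᵐ[volume.restrict (Ioo (-t) t)] 0 := by
  set h : ℝ → ℝ := fun x ↦ ∫ y in Ioo (-t) t, suzukiKernel ω ν (x + y) * f y with hh
  obtain ⟨hh2, hcontr⟩ : MemLp h 2 volume ∧ ∫ x : ℝ, h x ^ 2 ≤ ∫ y in Ioo (-t) t, f y ^ 2 :=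
    kernelImage_contraction hω hν hνω hE ht hf
  have hsq : Integrable (fun x ↦ h x ^ 2) := by
    have := (memLp_two_iff_integrable_sq_norm hh2.1).1 hh2
    exact this.congr (Eventually.of_forall fun x ↦ by simp [sq_abs])
  -- `∫_ℝ h² = ∫_{(−t,t)} h² + ∫_{(−t,t)ᶜ} h²`, so the complement part vanishes
  have hsplit := integral_add_compl (μ := (volume : Measure ℝ)) (s := Ioo (-t) t)
    measurableSet_Ioo hsq
  have hcompl_nonneg : 0 ≤ ∫ x in (Ioo (-t) t)ᶜ, h x ^ 2 := integral_nonneg fun x ↦ sq_nonneg _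
  have hcompl : ∫ x in (Ioo (-t) t)ᶜ, h x ^ 2 = 0 := by
    have : ∫ x : ℝ, h x ^ 2 ≤ ∫ x in Ioo (-t) t, h x ^ 2 := hcontr.trans hle
    linarith
  have hzero : ∀ᵐ x ∂(volume.restrict (Ioo (-t) t)ᶜ), h x = 0 := by
    have := (integral_eq_zero_iff_of_nonneg (fun x ↦ sq_nonneg (h x)) hsq.integrableOn).1 hcompl
    filter_upwards [this] with x hx
    simpa using hx
  -- `h` vanishes a.e. beyond `t`: Lemma 4.4 gives `h = 0`
  have hsub : Ioi t ⊆ (Ioo (-t) t)ᶜ := fun x hx hx' ↦ (not_lt.2 (le_of_lt hx)) hx'.2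
  have hR : ∀ᵐ x ∂(volume.restrict (Ioi t)), h x = 0 := ae_restrict_of_ae_restrict_of_subset hsub hzero
  have h44 : ∀ᵐ x : ℝ, h x = (0 : ℝ → ℝ) x :=
    Suzuki2021_lemma44_holds ω hω ν hν hνω t ht f hf ⟨t, hR⟩
  -- hence `∫_{(−t,t)} h² = 0` and `∫_{(−t,t)} f² ≤ 0`
  have hint0 : ∫ x in Ioo (-t) t, h x ^ 2 = 0 := by
    refine integral_eq_zero_of_ae ?_
    filter_upwards [ae_restrict_of_ae (s := Ioo (-t) t) h44] with x hx
    have hx' : h x = 0 := hx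
    simp [hx']
  have hf2 : Integrable (fun y ↦ f y ^ 2) (volume.restrict (Ioo (-t) t)) := by
    have := (memLp_two_iff_integrable_sq_norm hf.1).1 hf
    exact this.congr (Eventually.of_forall fun x ↦ by simp [sq_abs])
  have hfint0 : ∫ y in Ioo (-t) t, f y ^ 2 = 0 :=
    le_antisymm (by rw [hint0] at hle; exact hle) (integral_nonneg fun y ↦ sq_nonneg _)
  have := (integral_eq_zero_iff_of_nonneg (fun y ↦ sq_nonneg (f y)) hf2).1 hfint0
  filter_upwards [this] with y hy
  simpa using hy

end SuzukiConditionalWindows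

open SuzukiConditionalWindows in
/-- **[Su21] Prop. 4.4 ii), free-standing** (the first clause of `Suzuki2021_prop44_norm`): under
`E_ζ^{ω,ν} ∈ HB̄` and (2.8), for `t ≥ 0` and `0 ≠ f ∈ L²(−t,t)`,
`∫_{(−t,t)}(𝖪[t]f)² ≠ ∫_{(−t,t)} f²` («`‖𝖪[t]f‖ ≠ ‖f‖`»). RH-FREE as typed (HB̄ explicit).
[cite: Suzuki2021Hamiltonians, Prop. 4.4 ii)] -/
theorem Suzuki2021_prop44_ii {ω : ℝ} (hω : 0 < ω) {ν : ℕ} (hν : 1 ≤ ν) (hνω : 1 < (ν : ℝ) * ω)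
    (hE : IsSuzukiHBbar (suzukiE ω ν)) {t : ℝ} (ht : 0 ≤ t) {f : ℝ → ℝ}
    (hf : MemLp f 2 (volume.restrict (Ioo (-t) t))) (hf0 : ¬ f =ᵐ[volume.restrict (Ioo (-t) t)] 0) :
    ∫ x in Ioo (-t) t, (∫ y in Ioo (-t) t, suzukiKernel ω ν (x + y) * f y) ^ 2 ≠
      ∫ x in Ioo (-t) t, f x ^ 2 :=
  fun heq ↦ hf0 (ae_eq_zero_of_sq_integral_le hω hν hνω hE ht hf heq.symm.le)

open SuzukiConditionalWindows in
/-- **[Su21] Prop. 4.4 for `L = ζ` — DISCHARGE of the named fact `Suzuki2021_prop44`** (RH-FREE as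
typed): `ω > 0`, `ν ≥ 1`, `νω > 1`, `E_ζ^{ω,ν} ∈ HB` ⇒ for every `t ≥ 0`, `±1` is not an eigenvalue of
`f ↦ 𝟙_{(−t,t)}∫_{(−t,t)}K_ζ^{ω,ν}(·+y)f(y)dy` on `L²(−t,t)` («In particular, `1 ± 𝖪_L^{ω,ν}[t]` are
invertible»). Proof: an eigenfunction has `∫(𝖪[t]f)² = ∫f²`, contradicting Prop. 4.4 ii) unless `f = 0`
(printed proof followed — see the module docstring; Lemma 3.2's isometry replaced by the contraction
`kernelImage_contraction`, Lemma 4.4 = `Suzuki2021_lemma44_holds`).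
[cite: Suzuki2021Hamiltonians, Prop. 4.4 (with §2.5)] -/
theorem Suzuki2021_prop44_holds : Suzuki2021_prop44 := by
  intro ω hω ν hν hνω hHB t ht ε hε f hf heig
  refine ae_eq_zero_of_sq_integral_le hω hν hνω hHB.1 ht hf (le_of_eq ?_)
  refine integral_congr_ae ?_
  filter_upwards [heig] with x hx
  rw [hx, mul_pow]
  rcases hε with rfl | rfl <;> simp

/-- **The model regime is inhabited, unconditionally** ([Su21] Prop. 2.2 + Prop. 4.4): for `ω ≥ ½`,
`ν ≥ 1`, `νω > 1`, the operator `𝖪_ζ^{ω,ν}[t]` has no unit eigenvalue for ANY `t ≥ 0` — the Hamiltonian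
`H_ζ^{ω,ν}` exists on the whole half-line (the tree's `suzuki2021_windows_of_half_le` with its
hypothesis `Suzuki2021_prop44` discharged). RH-FREE. [cite: Suzuki2021Hamiltonians, Prop. 2.2 and Prop. 4.4] -/
theorem suzuki2021_windows_of_half_le' {ω : ℝ} (hω : 1 / 2 ≤ ω) {ν : ℕ} (hν : 1 ≤ ν)
    (hνω : 1 < (ν : ℝ) * ω) {t : ℝ} (ht : 0 ≤ t) : NoUnitEigenvalue (suzukiKernel ω ν) t :=
  suzuki2021_windows_of_half_le Suzuki2021_prop44_holds hω hν hνω ht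

end Literature.NumberTheory.LFunctions
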